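import Literature.AnabelianGeometry.EtaleTheta.RealifiedDivisorMonoidsOfRlfQ
import HarnessLib

/-!
# [FrdI] §0: the perfection `M^pf` and the groupification `M^gp` COMMUTE — the comparison
# homomorphism `(M^gp)^pf → (M^pf)^gp`

Mochizuki, *The geometry of Frobenioids I: the general theory*, Kyushu J. Math. **62** (2008)
293–400, §0 "Monoids", kurims text p. 11 [cite: MochizukiFrdI2008, §0 p.11]: "`M^gp`" (the
groupification), "`M^pf := lim_→ M`" (the inductive system `… → M —(n·)→ M → …` indexed by
`(N_{≥1}, ∣)`), "`M` is *perfect* if … `M → M^pf` is an isomorphism" [i.e. every `n`-th power map is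
bijective].  Used by [FrdII] Thm. 3.6 (i) (kurims p. 36): "`(Φ^fld)^ℚ := (Φ^fld)^pf`" is the rational
function monoid of `C^ℚ = C^pf`, whose divisor map `(Φ^fld)^pf → (Φ^pf)^gp` is the perfection of
`Φ^fld → Φ^gp` followed by the interchange `(Φ^gp)^pf → (Φ^pf)^gp` constructed here
[cite: MochizukiFrdII2008, Thm 3.6 (i) p.36].

General monoid file (abc-iut cell, layer L1, row M13-c3 piece P0 of
HOME/staging/L1/L1-t6/g3/M13-c3-DESIGN.md; seat abc-iut-L1-t6):
* `isPerfect_grothendieckGroup` — the groupification of a PERFECT commutative monoid is perfect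
  (uniquely divisible): `n`-th roots exist, and `z^n = 1` in `P^gp` forces `z = 1` (take `n`-th roots of
  the localisation witness);
* `isPerfect_gp_perfection M : IsPerfect ((M^pf)^gp)`;
* **`gpPerfComparison M : (M^gp)^pf →* (M^pf)^gp`** — THE interchange map: the unique extension to the
  perfection (`Perfection.extend`, target perfect) of `(ι_M)^gp : M^gp → (M^pf)^gp` (`gpMap (Perfection.of M)`);
  `gpPerfComparison_of`: it restricts to `(ι_M)^gp` on `M^gp`; `gpPerfComparison_naturality`: natural in `M`;
* `gpPerfComparisonNat Φ : (Φ^gp)^pf ⟶ (Φ^pf)^gp` — the same for a monoid `Φ` on a category `D`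
  (`perfectionFunctor (groupificationFunctor Φ) ⟶ groupificationFunctor (perfectionFunctor Φ)`), and
  `perfectionNatTrans η : Φ^pf ⟶ Ψ^pf` — functoriality of `(−)^pf` in the monoid `Φ` (componentwise
  `Perfection.map`), so that a homomorphism of monoids `B → Φ^gp` on `D` induces `B^pf → (Φ^pf)^gp`
  (`divPerfection`).
Classical monoid algebra; nothing here is specific to the abc programme or takes a side on [IUTchIII] Cor. 3.12.
-/

noncomputable section

namespace Literature.AlgebraicGeometry.Frobenioids

open CategoryTheory Opposite Function Literature.AnabelianGeometry.EtaleTheta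

universe w v u

/-! ### The groupification of a perfect monoid is perfect -/

section Monoid

variable {P : Type w} [CommMonoid P]

/-- In the groupification of a perfect monoid, `z ^ n = 1` (`n ≥ 1`) forces `z = 1`: if `c · a^n = c · s^n`
witnesses `(a/s)^n = 1`, write `c = d^n` and cancel the `n`-th power. [cite: MochizukiFrdI2008, §0 p.11] -/
theorem GrothendieckGroup.eq_one_of_pow_eq_one (hP : IsPerfect P) {n : ℕ} (hn : 0 < n)
    (z : Algebra.GrothendieckGroup P) (hz : z ^ n = 1) : z = 1 := by
  induction z using Localization.induction_on with
  | H p =>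
    obtain ⟨a, s⟩ := p
    rw [Localization.mk_pow, ← Localization.mk_one, Localization.mk_eq_mk_iff, Localization.r_iff_exists] at hz
    obtain ⟨c, hc⟩ := hz
    have hc' : (c : P) * a ^ n = (c : P) * (s : P) ^ n := by
      simpa only [Submonoid.coe_one, one_mul, mul_one, SubmonoidClass.coe_pow] using hc
    obtain ⟨d, hd⟩ := (hP.bijective_pow n hn).2 (c : P)
    have hd' : d ^ n = (c : P) := hd
    have h1 : (d * a) ^ n = (d * (s : P)) ^ n := by rw [mul_pow, mul_pow, hd', hc']
    have h2 : d * a = d * (s : P) := (hP.bijective_pow n hn).1 h1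
    rw [← Localization.mk_one, Localization.mk_eq_mk_iff, Localization.r_iff_exists]
    exact ⟨⟨d, Submonoid.mem_top d⟩, by simpa only [Submonoid.coe_one, one_mul, mul_one] using h2⟩

/-- **The groupification `P^gp` of a perfect commutative monoid `P` is perfect** (every `n`-th power map,
`n ≥ 1`, is bijective on `P^gp`). [cite: MochizukiFrdI2008, §0 p.11] -/
theorem isPerfect_grothendieckGroup (hP : IsPerfect P) : IsPerfect (Algebra.GrothendieckGroup P) := by
  refine ⟨fun n hn => ⟨fun x y hxy => ?_, fun x => ?_⟩⟩
  · have hxy' : x ^ n = y ^ n := hxy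
    have h : (x / y) ^ n = 1 := by rw [div_pow, hxy', div_self']
    exact div_eq_one.mp (GrothendieckGroup.eq_one_of_pow_eq_one hP hn _ h)
  · induction x using Localization.induction_on with
    | H p =>
      obtain ⟨a, s⟩ := p
      obtain ⟨a', ha'⟩ := (hP.bijective_pow n hn).2 a
      obtain ⟨s', hs'⟩ := (hP.bijective_pow n hn).2 (s : P)
      refine ⟨Localization.mk a' ⟨s', Submonoid.mem_top _⟩, ?_⟩
      have ha'' : a' ^ n = a := ha'
      have hs'' : s' ^ n = (s : P) := hs'
      change Localization.mk a' ⟨s', Submonoid.mem_top _⟩ ^ n = Localization.mk a s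
      rw [Localization.mk_pow, ha'']
      congr 1
      exact Subtype.ext (by rw [SubmonoidClass.coe_pow]; exact hs'')

variable (P) in
/-- `(M^pf)^gp` is perfect (`M^pf` is perfect, [FrdI] §0). [cite: MochizukiFrdI2008, §0 p.11] -/
theorem isPerfect_gp_perfection : IsPerfect (Algebra.GrothendieckGroup (Perfection P)) :=
  isPerfect_grothendieckGroup (isPerfect_perfection (M := P))

end Monoid

/-! ### The interchange `(M^gp)^pf → (M^pf)^gp` -/

section Comparison

variable (M : Type w) [CommMonoid M] {N : Type w} [CommMonoid N]

/-- **The interchange homomorphism `(M^gp)^pf → (M^pf)^gp`**: the unique extension to the perfection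
(`Perfection.extend`; the target is perfect) of `(ι_M)^gp : M^gp → (M^pf)^gp`, `ι_M : M → M^pf`.
[cite: MochizukiFrdI2008, §0 p.11] -/
def gpPerfComparison : Perfection (Algebra.GrothendieckGroup M) →* Algebra.GrothendieckGroup (Perfection M) :=
  Perfection.extend (isPerfect_gp_perfection M) (gpMap (Perfection.of M))

/-- The interchange restricts to `(ι_M)^gp` on `M^gp ⊆ (M^gp)^pf`. [cite: MochizukiFrdI2008, §0 p.11] -/
@[simp] theorem gpPerfComparison_of (z : Algebra.GrothendieckGroup M) :
    gpPerfComparison M (Perfection.of _ z) = gpMap (Perfection.of M) z :=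
  Perfection.extend_of _ _ z

/-- On `M` itself: `[a]^{gp,pf} ↦ [a]^{pf,gp}`. [cite: MochizukiFrdI2008, §0 p.11] -/
theorem gpPerfComparison_of_of (a : M) :
    gpPerfComparison M (Perfection.of _ (Algebra.GrothendieckGroup.of a)) =
      Algebra.GrothendieckGroup.of (Perfection.of M a) := by
  rw [gpPerfComparison_of, gpMap_of]

/-- As a composite: `gpPerfComparison ∘ ι = (ι_M)^gp`. [cite: MochizukiFrdI2008, §0 p.11] -/
theorem gpPerfComparison_comp_of :
    (gpPerfComparison M).comp (Perfection.of _) = gpMap (Perfection.of M) :=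
  MonoidHom.ext (gpPerfComparison_of M)

variable {M} in
/-- **Naturality of the interchange in `M`**: for `f : M → N`,
`gpPerfComparison_N ∘ (f^gp)^pf = (f^pf)^gp ∘ gpPerfComparison_M` (both are homomorphisms out of a
perfection into a perfect monoid agreeing with `(ι_N ∘ f)^gp` on `M^gp`). [cite: MochizukiFrdI2008, §0 p.11] -/
theorem gpPerfComparison_naturality (f : M →* N) :
    (gpPerfComparison N).comp (Perfection.map (gpMap f)) =
      (gpMap (Perfection.map f)).comp (gpPerfComparison M) := by
  apply Perfection.hom_ext_of_isPerfect (isPerfect_gp_perfection N)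
  rw [MonoidHom.comp_assoc, Perfection.map_comp_of, ← MonoidHom.comp_assoc, gpPerfComparison_comp_of,
    MonoidHom.comp_assoc, gpPerfComparison_comp_of, ← gpMap_comp, ← gpMap_comp, Perfection.map_comp_of]

end Comparison

/-! ### On monoids on a category `D`: `(Φ^gp)^pf ⟶ (Φ^pf)^gp`, and `(−)^pf` on homomorphisms of monoids -/

section Functors

variable {D : Type u} [Category.{v} D]

/-- Functoriality of `Φ ↦ Φ^pf` in the monoid: a homomorphism `η : Φ → Ψ` of monoids on `D` induces
`η^pf : Φ^pf → Ψ^pf`, componentwise `Perfection.map` (naturality from `Perfection.map_comp`).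
[cite: MochizukiFrdI2008, Def. 1.1(ii) p.19] -/
def perfectionNatTrans {Φ Ψ : Dᵒᵖ ⥤ CommMonCat.{w}} (η : Φ ⟶ Ψ) : perfectionFunctor Φ ⟶ perfectionFunctor Ψ where
  app A := CommMonCat.ofHom (Perfection.map (η.app A).hom)
  naturality A B f := by
    apply CommMonCat.hom_ext
    change (Perfection.map (η.app B).hom).comp (Perfection.map (Φ.map f).hom) =
      (Perfection.map (Ψ.map f).hom).comp (Perfection.map (η.app A).hom)
    rw [← Perfection.map_comp, ← Perfection.map_comp, ← CommMonCat.hom_comp, η.naturality f, CommMonCat.hom_comp]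

/-- Components of `η^pf`. [cite: MochizukiFrdI2008, Def. 1.1(ii) p.19] -/
@[simp] theorem perfectionNatTrans_app {Φ Ψ : Dᵒᵖ ⥤ CommMonCat.{w}} (η : Φ ⟶ Ψ) (A : Dᵒᵖ)
    (x : Perfection (Φ.obj A)) : ((perfectionNatTrans η).app A).hom x = Perfection.map (η.app A).hom x := rfl

/-- **The interchange `(Φ^gp)^pf ⟶ (Φ^pf)^gp`** for a monoid `Φ` on `D`: componentwise `gpPerfComparison`,
natural by `gpPerfComparison_naturality`. [cite: MochizukiFrdI2008, Def. 1.1(ii) p.19] -/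
def gpPerfComparisonNat (Φ : Dᵒᵖ ⥤ CommMonCat.{w}) :
    perfectionFunctor (groupificationFunctor Φ) ⟶ groupificationFunctor (perfectionFunctor Φ) where
  app A := CommMonCat.ofHom (gpPerfComparison (Φ.obj A))
  naturality A B f := by
    apply CommMonCat.hom_ext
    exact gpPerfComparison_naturality (Φ.map f).hom

/-- Components of the interchange on `[z]`, `z ∈ Φ(A)^gp`. [cite: MochizukiFrdI2008, Def. 1.1(ii) p.19] -/
@[simp] theorem gpPerfComparisonNat_app_of (Φ : Dᵒᵖ ⥤ CommMonCat.{w}) (A : Dᵒᵖ)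
    (z : Algebra.GrothendieckGroup (Φ.obj A)) :
    ((gpPerfComparisonNat Φ).app A).hom (Perfection.of _ z) = gpMap (Perfection.of (Φ.obj A)) z :=
  gpPerfComparison_of _ z

/-- **The perfected divisor map.** A homomorphism `δ : B → Φ^gp` of monoids on `D` (e.g. the rational
function monoid datum of a model Frobenioid, [FrdI] Thm. 5.2) induces `B^pf → (Φ^pf)^gp`:
`δ^pf : B^pf → (Φ^gp)^pf` followed by the interchange. This is the datum `(Φ^fld)^ℚ = (Φ^fld)^pf → (Φ^pf)^gp`
of [FrdII] Thm. 3.6 (i) at `Λ = ℚ`. [cite: MochizukiFrdII2008, Thm 3.6 (i) p.36] -/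
def divPerfection {Φ B : Dᵒᵖ ⥤ CommMonCat.{w}} (δ : B ⟶ groupificationFunctor Φ) :
    perfectionFunctor B ⟶ groupificationFunctor (perfectionFunctor Φ) :=
  perfectionNatTrans δ ≫ gpPerfComparisonNat Φ

/-- Components of the perfected divisor map on `[b]`, `b ∈ B(A)`: `[b]^pf ↦ (ι^gp)(δ(b))`.
[cite: MochizukiFrdII2008, Thm 3.6 (i) p.36] -/
theorem divPerfection_app_of {Φ B : Dᵒᵖ ⥤ CommMonCat.{w}} (δ : B ⟶ groupificationFunctor Φ) (A : Dᵒᵖ)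
    (b : B.obj A) :
    ((divPerfection δ).app A).hom (Perfection.of _ b) = gpMap (Perfection.of (Φ.obj A)) ((δ.app A).hom b) :=
  gpPerfComparison_of (Φ.obj A) ((δ.app A).hom b)

end Functors

end Literature.AlgebraicGeometry.Frobenioids

end
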